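import Summits.CriticalPhenomena.PercolationContinuityZ3.Theorems.PercNearOneGluingNoHeavyLowerTailSunflowerChainCombSorted
import HarnessLib
import HarnessLib.Audit

/-!
# `NoHeavyLowerTail` (crux stmt-CriticalPhenomena-4575), abstract sunflower cubic: the partition lemma ★ (`0 ≤ ZH`) holds on the
# whole CYCLIC-STAR family `CS(d₁,d₂,d₃)` — the family on which BOTH halves (Lemma A and Lemma B) of ★ fail — and on every
# three-block chain substitution into the cyclic-star quotient

Support file (seat `prim-ineq-gen-2` gen 20; `--supports stmt-CriticalPhenomena-4575`).  Nothing is asserted about the crux; no `sorry`, no named facts,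
no `native_decide` (`decide +kernel` computations at default heartbeats).  Memo: run/shared/lean/prim/prim-ineq-gen-2/THREEBLOCK-GEN20.md.

CONTEXT.  The partition lemma `PartitionLemmaH` (★, OPEN; ⟹ `H_{q+t}`, `γ`, `G₄`, `AG⁺` through `…SunflowerCloneHqt/CloneGamma`) is `3·(SA + SB) ≥ Ntri`:
the kernel-spectator and bottom-spectator antipodal-Gladkov surpluses pay for the rainbow 3-partitions.  "Lemma A" (`3·SA ≥ Ntri`) and "Lemma B"
(`3·SB ≥ Ntri`) are each false; the CYCLIC STARS `CS(d₁,d₂,d₃)` (ttrl cp-payer / prim-ineq-prove-1 g29 §7; `…SunflowerPurePayerRefutation`: `not_purePayer`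
on `CS(3,3,3)`, `m = 9`, `(SA, SB, Ntri) = (432, 326, 1302)`, `ZH = 972`) are the standing test objects on which BOTH fail, i.e. on which any proof of ★ must
let the rainbows draw on kernel AND bottom slack simultaneously.  Until now ★ on this family was census knowledge only.

SETTING (prim-l12-p2 g9, `…SunflowerCompositionChain`).  A three-block CHAIN SUBSTITUTION `G ∘ h` reads a subset `S` of `E₀ ⊔ E₁ ⊔ E₂` through monotone
block statistics `lv_b(S ∩ E_b) ∈ {0,…,r_b}` and labels it by the quotient `G` (a sunflower on the threshold set `Σ b, Fin (r b)`, read on staircases);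
`Sunflower.ZH_composeC_nonneg_of_comb`: if every CLASS FIBRE SUM `ZFC s6H G c` (sum of the kernel over the level-triple families `L` whose blockwise
sorted form is `c`) is `≥ 0` ("COMB_chain(G)"), then `0 ≤ ZH (G ∘ h)` for every `h` of the given heights.  The cyclic star `CS(d₁,d₂,d₃)` is the case
`r ≡ 2`, `lv_b` = the block STATE (0 = `S` misses `E_b`, 1 = meets it partially, 2 = contains it; `stateGadget`), quotient = `csQuot`:
`U_j := (level_{j+1} ≥ 1 ∧ level_{j+2} ≥ 1) ∨ level_{j+1} = 2` ("`S` meets both other blocks, or contains the next one"), `V_k := U_k ∨ (two of the U's)`.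

THIS FILE.
* (companion `…SunflowerChainCombSorted`, general heights and blocks: `ChainComb.comb_chain_of_sorted` — COMB_chain follows from the sums of `KC` over the
  blockwise REARRANGEMENTS of the blockwise SORTED classes.)
* §1: the cyclic-star quotient `csQuot : Sunflower (Σ b : Fin 3, Fin 2)`, its label as an explicit function of the three block levels (`csQuot_lab`,
  `KC_csQuot`), and **`comb_csQuot : ∀ c, 0 ≤ ZFC s6H csQuot c`** — the 1000 sorted classes, each a sum of at most 216 kernel values, checked by
  `decide +kernel` in ten slices at default heartbeats (`comb_csQuot_slice0…9`, `comb_csQuot_table`; minimum class sum `0`).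
* §2: **`ZH_nonneg_csQuot_composeC`** — ★ for EVERY chain substitution of heights 2 into the cyclic-star quotient (arbitrary monotone three-level block
  statistics, e.g. thresholds `#(S ∩ E_b) ≥ t₁, ≥ t₂`), and **`ZH_nonneg_cyclicStar`** — ★ on `CS(β 0, β 1, β 2)` for ALL block types, with
  `mem_cyclicStar_V` identifying the composed up-sets with the cyclic-star generators read on block states.
Numerically (memo; exact, brute force `m ≤ 10` agrees with the class-sum formula): `ZH(CS(d,d,d)) = 0, 144, 972, 4680, 19980, 81144` for `d = 1,…,6`
(`d = 3`: prove-1 g29's `972`), `ZH(CS(2,3,4)) = 1260`.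
WIDER FACT (memo, computational, NOT formalised here): COMB_chain holds for EVERY monotone quotient `[3]³ → M₃` (595 433 maps up to petal names) and all
three kernels `s6H, s6G, s6T` — so ★_H, ★_G, ★_T hold for every three-block chain substitution of heights `≤ 2`; the cyclic-star quotient is the instance
replayed in the kernel here.
-/

namespace Summit.CriticalPhenomena.PercolationContinuityZ3.Theorems.SunflowerPartition

open Finset

/-! ## §1. The cyclic-star quotient and its class fibre sums -/

namespace CyclicStarQuot

open ChainComb

/-- Heights `2` on three blocks (three levels `0 < 1 < 2` per block). [this work] -/
abbrev r2 : Fin 3 → ℕ := fun _ => 2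

/-- "At least two of three". [this work] -/
def top3 (u : Fin 3 → Bool) : Bool := (u 0 && u 1) || (u 0 && u 2) || (u 1 && u 2)

/-- The `θ`-pullback up-set `k` of three generators: `U_k`, or at least two of the `U`'s. [this work] -/
def vee3 (u : Fin 3 → Bool) (k : Fin 3) : Bool := u k || top3 u

/-- All pairwise meets of the `θ`-pullback up-sets coincide. [this work] -/
theorem vee3_and_vee3 : ∀ (u : Fin 3 → Bool) (i j : Fin 3), i ≠ j → (vee3 u i && vee3 u j) = (vee3 u 0 && vee3 u 1) := by
  decide

/-- The `θ`-pullback up-sets are monotone in the generators. [this work] -/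
theorem vee3_mono : ∀ (u u' : Fin 3 → Bool) (k : Fin 3), (∀ j, u j = true → u' j = true) → vee3 u k = true → vee3 u' k = true := by
  decide

/-- The `M₃`-label of the `θ`-pullback: `4` (kernel) if two generators hold, `j+1` (petal `j`) if only `U_j`, `0` (bottom) if none. [this work] -/
def lab3 (u : Fin 3 → Bool) : Fin 5 :=
  if top3 u then 4 else if u 0 then 1 else if u 1 then 2 else if u 2 then 3 else 0

/-- The cyclic-star generators read on block LEVELS `ℓ`: `U_j ⟺ (ℓ(j+1) ≥ 1 ∧ ℓ(j+2) ≥ 1) ∨ ℓ(j+1) ≥ 2`. [this work] -/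
def csU (ℓ : Fin 3 → ℕ) : Fin 3 → Bool := fun j => decide ((1 ≤ ℓ (j + 1) ∧ 1 ≤ ℓ (j + 2)) ∨ 2 ≤ ℓ (j + 1))

/-- The generators are monotone in the levels. [this work] -/
theorem csU_mono {ℓ ℓ' : Fin 3 → ℕ} (h : ∀ b, ℓ b ≤ ℓ' b) (j : Fin 3) (hj : csU ℓ j = true) : csU ℓ' j = true := by
  simp only [csU, decide_eq_true_eq] at hj ⊢
  rcases hj with ⟨h1, h2⟩ | h3
  · exact Or.inl ⟨le_trans h1 (h _), le_trans h2 (h _)⟩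
  · exact Or.inr (le_trans h3 (h _))

/-- The level of block `b` in a subset of the threshold set: the number of its thresholds that are on. [this work] -/
def lvl (S : Finset (Σ b : Fin 3, Fin (r2 b))) (b : Fin 3) : ℕ := #(slice S b)

/-- Levels are monotone. [this work] -/
theorem lvl_mono {S T : Finset (Σ b : Fin 3, Fin (r2 b))} (hST : S ⊆ T) (b : Fin 3) : lvl S b ≤ lvl T b :=
  card_le_card (slice_mono hST b)

/-- **The cyclic-star quotient**: the sunflower on the threshold set `Σ b : Fin 3, Fin 2` whose up-set `k` is
`U_k ∨ (two of U₀,U₁,U₂)` with `U_j = (level_{j+1} ≥ 1 ∧ level_{j+2} ≥ 1) ∨ level_{j+1} ≥ 2`. [this work] -/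
def csQuot : Sunflower (Σ b : Fin 3, Fin (r2 b)) where
  V k := univ.filter fun S => vee3 (csU (lvl S)) k = true
  upper := by
    intro k S T hST hS
    have hS' : S ∈ univ.filter fun S : Finset (Σ b : Fin 3, Fin (r2 b)) => vee3 (csU (lvl S)) k = true := hS
    show T ∈ univ.filter fun S : Finset (Σ b : Fin 3, Fin (r2 b)) => vee3 (csU (lvl S)) k = true
    rw [mem_filter] at hS' ⊢
    exact ⟨mem_univ _, vee3_mono _ _ k (fun j hj => csU_mono (fun b => lvl_mono hST b) j hj) hS'.2⟩
  inter_eq := by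
    intro i j hij
    ext S
    simp only [mem_inter, mem_filter, mem_univ, true_and]
    rw [← Bool.and_eq_true, ← Bool.and_eq_true, vee3_and_vee3 _ i j hij]

/-- Membership in the up-sets of the quotient. [this work] -/
theorem mem_csQuot_V (k : Fin 3) (S : Finset (Σ b : Fin 3, Fin (r2 b))) : S ∈ csQuot.V k ↔ vee3 (csU (lvl S)) k = true := by
  show S ∈ univ.filter (fun S : Finset (Σ b : Fin 3, Fin (r2 b)) => vee3 (csU (lvl S)) k = true) ↔ _
  rw [mem_filter]
  simp

/-- **The label of the quotient is `lab3` of the generators read on the levels.** [this work] -/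
theorem csQuot_lab (S : Finset (Σ b : Fin 3, Fin (r2 b))) : csQuot.lab S = lab3 (csU (lvl S)) := by
  unfold Sunflower.lab Sunflower.A
  simp only [mem_inter, mem_csQuot_V]
  generalize csU (lvl S) = u
  revert u
  decide

/-- The block levels of the staircase family of a level triple. [this work] -/
theorem lvl_st (L : ∀ b : Fin 3, Fin 3 → Fin (r2 b + 1)) (k : Fin 3) (b : Fin 3) : lvl (st L k) b = (L b k).val := by
  unfold lvl
  have h1 : slice (st L k) b = univ.filter fun t : Fin (r2 b) => t.val < (L b k).val := by
    ext t
    simp [st, mem_slice]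
  rw [h1]
  have key : ∀ v : Fin 3, #(univ.filter fun t : Fin 2 => t.val < v.val) = v.val := by decide
  exact key (L b k)

/-- The kernel value of a level-triple family for the cyclic-star quotient, as an explicit function of the levels. [this work] -/
def KCcs (L : ∀ b : Fin 3, Fin 3 → Fin (r2 b + 1)) : ℤ :=
  s6H (lab3 (csU fun b => (L b 0).val)) (lab3 (csU fun b => (L b 1).val)) (lab3 (csU fun b => (L b 2).val))

/-- `KC s6H csQuot = KCcs`. [this work] -/
theorem KC_csQuot (L : ∀ b : Fin 3, Fin 3 → Fin (r2 b + 1)) : KC s6H csQuot L = KCcs L := by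
  unfold KC KCcs
  have h : ∀ k : Fin 3, lvl (st L k) = fun b => (L b k).val := fun k => funext (lvl_st L k)
  rw [csQuot_lab, csQuot_lab, csQuot_lab, h 0, h 1, h 2]

/-- The value table of `s6H` (a computational cache; cf. `s6H_table` of `…SunflowerCloneHqt`). [this work] -/
def s6Htab : Fin 5 → Fin 5 → Fin 5 → ℤ :=
  ![![![0, 0, 0, 0, 2], ![0, 0, -1, -1, 0], ![0, -1, 0, -1, 0], ![0, -1, -1, 0, 0], ![2, 0, 0, 0, 2]],
    ![![0, 0, -1, -1, 0], ![0, 0, 0, 0, 0], ![-1, 0, 0, -1, -1], ![-1, 0, -1, 0, -1], ![0, 0, -1, -1, 0]],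
    ![![0, -1, 0, -1, 0], ![-1, 0, 0, -1, -1], ![0, 0, 0, 0, 0], ![-1, -1, 0, 0, -1], ![0, -1, 0, -1, 0]],
    ![![0, -1, -1, 0, 0], ![-1, 0, -1, 0, -1], ![-1, -1, 0, 0, -1], ![0, 0, 0, 0, 0], ![0, -1, -1, 0, 0]],
    ![![2, 0, 0, 0, 2], ![0, 0, -1, -1, 0], ![0, -1, 0, -1, 0], ![0, -1, -1, 0, 0], ![2, 0, 0, 0, 0]]]

/-- `s6H` is its value table. [this work] -/
theorem s6H_eq_s6Htab : ∀ x y z : Fin 5, s6H x y z = s6Htab x y z := by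
  decide

/-- The label table of the cyclic-star quotient as a function of the three block levels. [this work] -/
def csLab : Fin 3 → Fin 3 → Fin 3 → Fin 5 :=
  ![![![0, 0, 2], ![0, 1, 4], ![1, 1, 4]],
    ![![0, 2, 2], ![3, 4, 4], ![4, 4, 4]],
    ![![3, 4, 4], ![3, 4, 4], ![4, 4, 4]]]

/-- The label table is `lab3 ∘ csU` on levels. [this work] -/
theorem lab3_csU_eq_csLab : ∀ v : Fin 3 → Fin 3, lab3 (csU fun b => (v b).val) = csLab (v 0) (v 1) (v 2) := by
  decide

/-- The kernel value of a level-triple family, table form (for kernel evaluation). [this work] -/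
def KCcsT (L : ∀ b : Fin 3, Fin 3 → Fin (r2 b + 1)) : ℤ :=
  s6Htab (csLab (L 0 0) (L 1 0) (L 2 0)) (csLab (L 0 1) (L 1 1) (L 2 1)) (csLab (L 0 2) (L 1 2) (L 2 2))

/-- `KCcs = KCcsT`. [this work] -/
theorem KCcs_eq_KCcsT (L : ∀ b : Fin 3, Fin 3 → Fin (r2 b + 1)) : KCcs L = KCcsT L := by
  unfold KCcs KCcsT
  rw [s6H_eq_s6Htab, lab3_csU_eq_csLab (fun b => L b 0), lab3_csU_eq_csLab (fun b => L b 1), lab3_csU_eq_csLab (fun b => L b 2)]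

/-- The ten sorted level triples. [this work] -/
def sorted3 : Fin 10 → Fin 3 → Fin 3 :=
  ![![0, 0, 0], ![0, 0, 1], ![0, 0, 2], ![0, 1, 1], ![0, 1, 2], ![0, 2, 2], ![1, 1, 1], ![1, 1, 2], ![1, 2, 2], ![2, 2, 2]]

/-- Every sorted triple of levels is in the table. [this work] -/
theorem exists_sorted3_eq : ∀ u : Fin 3 → Fin 3, (∀ i j : Fin 3, i ≤ j → u i ≤ u j) → ∃ q : Fin 10, sorted3 q = u := by
  decide

/-- The class (level-triple family) encoded by three table indices. [this work] -/
def csCls (q : Fin 3 → Fin 10) : ∀ b : Fin 3, Fin 3 → Fin (r2 b + 1) := fun b => sorted3 (q b)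

/-- The finite check, slice `q₀ = 0` (100 sorted classes, `decide +kernel` at default heartbeats). [this work] -/
theorem comb_csQuot_slice0 : ∀ q₁ q₂ : Fin 10,
    0 ≤ ∑ L ∈ Fintype.piFinset (fun b => rearrI (csCls ![0, q₁, q₂] b)), KCcsT L := by
  decide +kernel

/-- The finite check, slice `q₀ = 1` (100 sorted classes, `decide +kernel` at default heartbeats). [this work] -/
theorem comb_csQuot_slice1 : ∀ q₁ q₂ : Fin 10,
    0 ≤ ∑ L ∈ Fintype.piFinset (fun b => rearrI (csCls ![1, q₁, q₂] b)), KCcsT L := by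
  decide +kernel

/-- The finite check, slice `q₀ = 2` (100 sorted classes, `decide +kernel` at default heartbeats). [this work] -/
theorem comb_csQuot_slice2 : ∀ q₁ q₂ : Fin 10,
    0 ≤ ∑ L ∈ Fintype.piFinset (fun b => rearrI (csCls ![2, q₁, q₂] b)), KCcsT L := by
  decide +kernel

/-- The finite check, slice `q₀ = 3` (100 sorted classes, `decide +kernel` at default heartbeats). [this work] -/
theorem comb_csQuot_slice3 : ∀ q₁ q₂ : Fin 10,
    0 ≤ ∑ L ∈ Fintype.piFinset (fun b => rearrI (csCls ![3, q₁, q₂] b)), KCcsT L := by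
  decide +kernel

/-- The finite check, slice `q₀ = 4` (100 sorted classes, `decide +kernel` at default heartbeats). [this work] -/
theorem comb_csQuot_slice4 : ∀ q₁ q₂ : Fin 10,
    0 ≤ ∑ L ∈ Fintype.piFinset (fun b => rearrI (csCls ![4, q₁, q₂] b)), KCcsT L := by
  decide +kernel

/-- The finite check, slice `q₀ = 5` (100 sorted classes, `decide +kernel` at default heartbeats). [this work] -/
theorem comb_csQuot_slice5 : ∀ q₁ q₂ : Fin 10,
    0 ≤ ∑ L ∈ Fintype.piFinset (fun b => rearrI (csCls ![5, q₁, q₂] b)), KCcsT L := by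
  decide +kernel

/-- The finite check, slice `q₀ = 6` (100 sorted classes, `decide +kernel` at default heartbeats). [this work] -/
theorem comb_csQuot_slice6 : ∀ q₁ q₂ : Fin 10,
    0 ≤ ∑ L ∈ Fintype.piFinset (fun b => rearrI (csCls ![6, q₁, q₂] b)), KCcsT L := by
  decide +kernel

/-- The finite check, slice `q₀ = 7` (100 sorted classes, `decide +kernel` at default heartbeats). [this work] -/
theorem comb_csQuot_slice7 : ∀ q₁ q₂ : Fin 10,
    0 ≤ ∑ L ∈ Fintype.piFinset (fun b => rearrI (csCls ![7, q₁, q₂] b)), KCcsT L := by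
  decide +kernel

/-- The finite check, slice `q₀ = 8` (100 sorted classes, `decide +kernel` at default heartbeats). [this work] -/
theorem comb_csQuot_slice8 : ∀ q₁ q₂ : Fin 10,
    0 ≤ ∑ L ∈ Fintype.piFinset (fun b => rearrI (csCls ![8, q₁, q₂] b)), KCcsT L := by
  decide +kernel

/-- The finite check, slice `q₀ = 9` (100 sorted classes, `decide +kernel` at default heartbeats). [this work] -/
theorem comb_csQuot_slice9 : ∀ q₁ q₂ : Fin 10,
    0 ≤ ∑ L ∈ Fintype.piFinset (fun b => rearrI (csCls ![9, q₁, q₂] b)), KCcsT L := by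
  decide +kernel

/-- **The finite check**: for each of the `1000` sorted classes the kernel summed over its rearrangements is `≥ 0` (minimum `0`). [this work] -/
theorem comb_csQuot_table (q₀ q₁ q₂ : Fin 10) :
    0 ≤ ∑ L ∈ Fintype.piFinset (fun b => rearr (csCls ![q₀, q₁, q₂] b)), KCcs L := by
  have e1 : (fun b => rearr (csCls ![q₀, q₁, q₂] b)) = fun b => rearrI (csCls ![q₀, q₁, q₂] b) :=
    funext fun b => (rearrI_eq _).symm
  rw [e1, sum_congr rfl fun L _ => KCcs_eq_KCcsT L]
  fin_cases q₀
  exacts [comb_csQuot_slice0 q₁ q₂, comb_csQuot_slice1 q₁ q₂, comb_csQuot_slice2 q₁ q₂, comb_csQuot_slice3 q₁ q₂,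
    comb_csQuot_slice4 q₁ q₂, comb_csQuot_slice5 q₁ q₂, comb_csQuot_slice6 q₁ q₂, comb_csQuot_slice7 q₁ q₂,
    comb_csQuot_slice8 q₁ q₂, comb_csQuot_slice9 q₁ q₂]

/-- **COMB_chain for the cyclic-star quotient**: every class fibre sum of `s6H` is nonnegative. [this work] -/
theorem comb_csQuot : ∀ c : (∀ b : Fin 3, Fin 3 → Fin (r2 b + 1)), 0 ≤ ZFC s6H csQuot c := by
  refine comb_chain_of_sorted s6H csQuot fun c hc => ?_
  have hq : ∀ b, ∃ q : Fin 10, sorted3 q = c b := fun b => exists_sorted3_eq (c b) (fun i j hij => hc b hij)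
  choose q hq using hq
  have hc' : c = csCls ![q 0, q 1, q 2] := by
    funext b
    fin_cases b
    · exact (hq 0).symm
    · exact (hq 1).symm
    · exact (hq 2).symm
  have e : ∀ L ∈ Fintype.piFinset (fun b => rearr (c b)), KC s6H csQuot L = KCcs L := fun L _ => KC_csQuot L
  rw [sum_congr rfl e, hc']
  exact comb_csQuot_table (q 0) (q 1) (q 2)

/-! ## §2. ★ on every chain substitution into the cyclic-star quotient, and on the cyclic stars -/

variable {β : Fin 3 → Type*} [∀ b, Fintype (β b)] [∀ b, DecidableEq (β b)]

/-- **★_H for every three-block chain substitution of heights `2` into the cyclic-star quotient** (arbitrary monotone three-level block statistics,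
arbitrary blocks). [this work] -/
theorem ZH_nonneg_csQuot_composeC (h : CGadget β r2) : 0 ≤ (csQuot.composeC h).ZH :=
  csQuot.ZH_composeC_nonneg_of_comb h comb_csQuot

/-- The block-STATE gadget: level `2` if the set contains the block, `0` if it misses it, `1` otherwise. [this work] -/
def stateGadget (β : Fin 3 → Type*) [∀ b, Fintype (β b)] [∀ b, DecidableEq (β b)] : CGadget β r2 where
  lv _ S := if S = univ then 2 else if S = ∅ then 0 else 1
  mono := by
    intro b S T hST
    show (if S = univ then (2 : Fin 3) else if S = ∅ then 0 else 1) ≤ (if T = univ then 2 else if T = ∅ then 0 else 1)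
    by_cases hT : T = univ
    · rw [if_pos hT]
      split_ifs <;> decide
    · have hS : S ≠ univ := fun h => hT (univ_subset_iff.1 (h ▸ hST))
      by_cases hS0 : S = ∅
      · rw [if_neg hS, if_pos hS0]
        split_ifs <;> decide
      · have hT0 : T ≠ ∅ := fun h => hS0 (subset_empty.1 (h ▸ hST))
        rw [if_neg hS, if_neg hS0, if_neg hT, if_neg hT0]

/-- **THE CYCLIC STARS SATISFY ★**: `0 ≤ ZH (CS(β 0, β 1, β 2))` for all block types — the first theorem for ★ on a family where both pure payers fail
(`CS(3,3,3)`: `3·SA − Ntri = −6`, `3·SB − Ntri = −324`, `ZH = 972`). [this work] -/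
theorem ZH_nonneg_cyclicStar (β : Fin 3 → Type*) [∀ b, Fintype (β b)] [∀ b, DecidableEq (β b)] :
    0 ≤ (csQuot.composeC (stateGadget β)).ZH :=
  ZH_nonneg_csQuot_composeC (stateGadget β)

/-- The block levels of a hit set are the gadget levels. [this work] -/
theorem lvl_hits (h : CGadget β r2) (S : Finset (Σ b, β b)) (b : Fin 3) : lvl (h.hits S) b = (h.lv b (slice S b)).val := by
  unfold lvl
  have h1 : slice (h.hits S) b = univ.filter fun t : Fin (r2 b) => t.val < (h.lv b (slice S b)).val := by
    ext t
    simp [mem_slice]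
  rw [h1]
  have key : ∀ v : Fin 3, #(univ.filter fun t : Fin 2 => t.val < v.val) = v.val := by decide
  exact key (h.lv b (slice S b))

/-- **Identification**: a set lies in the up-set `k` of the cyclic star iff `U_k ∨ (two of the U's)` holds for the generators
`U_j = (state_{j+1} ≥ 1 ∧ state_{j+2} ≥ 1) ∨ state_{j+1} = 2` read on its three block states ("meets both other blocks, or contains the next one"),
i.e. this is the cyclic star `CS` of prim-ineq-prove-1 g29 §7 / `…SunflowerCyclicStarLaw`. [this work] -/
theorem mem_cyclicStar_V (S : Finset (Σ b, β b)) (k : Fin 3) :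
    S ∈ (csQuot.composeC (stateGadget β)).V k ↔ vee3 (csU fun b => ((stateGadget β).lv b (slice S b)).val) k = true := by
  rw [Sunflower.mem_composeC_V, mem_csQuot_V]
  have h : lvl ((stateGadget β).hits S) = fun b => ((stateGadget β).lv b (slice S b)).val := funext (lvl_hits (stateGadget β) S)
  rw [h]

end CyclicStarQuot

end Summit.CriticalPhenomena.PercolationContinuityZ3.Theorems.SunflowerPartition
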